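import Mathlib
import Summits.AtomisticToContinuum.BoseEinsteinCondensation.Theorems.DeepInfraredEmptinessShellInvSum

/-! # `stub_deepShellInvSum` of the registered `weak` skeleton v2 (sha 6417f3f1…, item stmt-AtomisticToContinuum-27506) —
BY NAME + VERBATIM (expanded) SIGNATURE, from the landed lattice sum `InvSumDF.deepShellInvSum` (p805747).
decomp-a2c lens-6 g23; def-free; to be landed `--supports stmt-AtomisticToContinuum-27506` (no `--as helper`). -/

namespace Summit.AtomisticToContinuum.BoseEinsteinCondensation.Cruxes.DeepInfraredEmptiness.WeakV2

/-- REGISTERED STUB `stub_deepShellInvSum` of the weak skeleton v2 (6417f3f1) on `DeepInfraredEmptiness` (stmt-AtomisticToContinuum-27506), by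
name and with the expanded registered signature: the deep-shell inverse lattice sum `Σ 1/ε(q) ≤ C₀ √θ K³`, from the landed `InvSumDF.deepShellInvSum`. -/
theorem stub_deepShellInvSum :
    ∃ C₀ : ℝ, 0 < C₀ ∧ ∀ K : ℕ, 0 < K → ∀ θ : ℝ, 0 < θ → (∑ q ∈ (Finset.univ.filter fun q : Fin 3 → Fin K => ¬ (∀ j : Fin 3, (q j : ℕ) = 0) ∧ (∑ j : Fin 3, (1 - Real.cos (2 * Real.pi * ((q j : ℕ) : ℝ) / (K : ℝ)))) < θ), 1 / (∑ j : Fin 3, (1 - Real.cos (2 * Real.pi * ((q j : ℕ) : ℝ) / (K : ℝ))))) ≤ C₀ * Real.sqrt θ * (K : ℝ) ^ 3 :=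
  Summit.AtomisticToContinuum.BoseEinsteinCondensation.Cruxes.DeepInfraredEmptiness.InvSumDF.deepShellInvSum

end Summit.AtomisticToContinuum.BoseEinsteinCondensation.Cruxes.DeepInfraredEmptiness.WeakV2
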